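import Mathlib
import HarnessLib
import Literature.Analysis.PDE.DivFormLiouville
import Summits.NavierStokesRegularity.NavierStokesRegularity.Theorems.PoloidalWindowDoorPoloidalWindowRigidityDivFormCaccioppoli

/-!
# Route `PoloidalWindowDoor`, crux K2 (stmt-NavierStokesRegularity-19708) — task H5: REDUCTION of the named fact
# `Literature.Analysis.PDE.divFormLiouville` (De Giorgi–Nash–Moser Liouville theorem) to the UNIT-BALL HARNACK
# INEQUALITY in dimensions `≥ 3`

Setting = the rendering of the named fact `divFormLiouville` (Jost, *PDE*, Thm 14.2.3; Moser 1961): coefficients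
`a : ℝⁿ → Matₙ(ℝ)` measurable, symmetric, `λ|ξ|² ≤ ξ·aξ`, `|aᵢⱼ| ≤ Λ`; `u ∈ C¹(ℝⁿ)` an entire weak solution,
`∫ Σᵢⱼ aᵢⱼ ∂ᵢu ∂ⱼη = 0` for all `η ∈ C¹_c`.  This file is the part of Moser's route that does NOT use the
Caccioppoli/Sobolev/John–Nirenberg machinery (milestones M1–M3, files `…DivFormCaccioppoli*`, seat K2-p3):

* `weak_affine` — entire weak solutions are stable under `u ↦ c·u + d`;
* `weak_comp_affine` — … and under the affine changes of variables `x ↦ x₀ + R·x`, `R ≠ 0`, the coefficients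
  becoming `a(x₀ + R·x)` (same ellipticity constants): Moser's SCALING COVARIANCE;
* `liouville_of_unitHarnack` — **Harnack ⇒ Liouville**: if ONE constant `C = C(n,λ,Λ)` gives `u(x) ≤ C·u(y)` on the
  unit ball for every admissible coefficient field and every entire `C¹` weak solution `u ≥ 1`, then every bounded
  entire `C¹` weak solution is constant (apply Harnack to `(u − inf u + ε)/ε` on dilated balls; no oscillation
  iteration is needed for the Liouville corollary);
* (sequel file `…DivFormLift`: `liouville_lift` — dimension lifting `n + 1 ⇒ n` by Fubini, replacing the capacity /
  ODE arguments for `n ≤ 2` — and the assembly `divFormLiouville_of_unitHarnack_three_le`: the unit-ball Harnack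
  inequality for all `n ≥ 3` implies the named fact `divFormLiouville` in every dimension).

So the DISCHARGE of the fact is reduced to Moser's Harnack inequality on `B(0,1)` for entire positive solutions in
dimensions `n ≥ 3` (where the Gagliardo–Nirenberg–Sobolev inequality with `p = 2` is available), with a constant
depending only on `(n, λ, Λ)`.
Housed under the route's Theorems as a HELPER of the crux (consumer: the K2 lead's CONDITIONAL elliptic-slope stratum
`…EllipticSlope.eq_zero_of_ellipticShear`, p482138, conditional on `divFormLiouville`); seat nsreg-p6 g7, no claim
(the fact's claim #1 is K2-p3's).

WHAT THIS IS NOT: not the Liouville theorem and not the Harnack inequality — a reduction between them; nothing here is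
specific to Navier–Stokes.
-/

noncomputable section

open MeasureTheory Set Function Filter Topology Metric
open scoped Matrix

-- the summit and its single sub-problem share the name (CONVENTIONS §1), as in every Theorems file
set_option linter.dupNamespace false

namespace Summit.NavierStokesRegularity.NavierStokesRegularity.Theorems.PoloidalWindowDoorPoloidalWindowRigidityDivFormReduction

open Summit.NavierStokesRegularity.NavierStokesRegularity.Theorems.PoloidalWindowDoorPoloidalWindowRigidityDivFormCaccioppoli

variable {n : ℕ}

/-! ### Covariance of the weak formulation -/

variable {a : EuclideanSpace ℝ (Fin n) → Matrix (Fin n) (Fin n) ℝ} {u : EuclideanSpace ℝ (Fin n) → ℝ}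

/-- Entire weak solutions are stable under `u ↦ c·u + d`. -/
theorem weak_affine (hu : ContDiff ℝ 1 u)
    (hweak : ∀ η : EuclideanSpace ℝ (Fin n) → ℝ, ContDiff ℝ 1 η → HasCompactSupport η →
      ∫ y, ∑ i, ∑ j, a y i j * fderiv ℝ u y (EuclideanSpace.single i 1) *
        fderiv ℝ η y (EuclideanSpace.single j 1) = 0)
    (c d : ℝ) :
    ∀ η : EuclideanSpace ℝ (Fin n) → ℝ, ContDiff ℝ 1 η → HasCompactSupport η →
      ∫ y, ∑ i, ∑ j, a y i j * fderiv ℝ (fun y => c * u y + d) y (EuclideanSpace.single i 1) *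
        fderiv ℝ η y (EuclideanSpace.single j 1) = 0 := by
  intro η hη hηc
  have hd : ∀ y (w : EuclideanSpace ℝ (Fin n)),
      fderiv ℝ (fun y => c * u y + d) y w = c * fderiv ℝ u y w := by
    intro y w
    have h := (((hu.differentiable one_ne_zero) y).hasFDerivAt.const_mul c).add_const d
    rw [h.fderiv]
    simp
  simp_rw [hd]
  have hpt : ∀ y, ∑ i, ∑ j, a y i j * (c * fderiv ℝ u y (EuclideanSpace.single i 1)) *
        fderiv ℝ η y (EuclideanSpace.single j 1) =
      c * ∑ i, ∑ j, a y i j * fderiv ℝ u y (EuclideanSpace.single i 1) *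
        fderiv ℝ η y (EuclideanSpace.single j 1) := by
    intro y
    simp only [Finset.mul_sum]
    exact Finset.sum_congr rfl fun i _ => Finset.sum_congr rfl fun j _ => by ring
  simp_rw [hpt]
  rw [integral_const_mul, hweak η hη hηc, mul_zero]

/-- The chain rule along the affine map `x ↦ x₀ + R·x`: `D(f ∘ T)(x)[w] = R · Df(T x)[w]`. -/
theorem fderiv_comp_affine {f : EuclideanSpace ℝ (Fin n) → ℝ} (x₀ : EuclideanSpace ℝ (Fin n)) (R : ℝ)
    {x : EuclideanSpace ℝ (Fin n)} (hf : DifferentiableAt ℝ f (x₀ + R • x)) (w : EuclideanSpace ℝ (Fin n)) :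
    fderiv ℝ (fun y => f (x₀ + R • y)) x w = R * fderiv ℝ f (x₀ + R • x) w := by
  have hT : HasFDerivAt (fun y : EuclideanSpace ℝ (Fin n) => x₀ + R • y)
      (R • ContinuousLinearMap.id ℝ (EuclideanSpace ℝ (Fin n))) x :=
    ((hasFDerivAt_id x).const_smul R).const_add x₀
  have h := hf.hasFDerivAt.comp x hT
  rw [show (fun y => f (x₀ + R • y)) = f ∘ (fun y => x₀ + R • y) from rfl, h.fderiv]
  simp

/-- **Scaling covariance (Moser).**  If `u` is an entire `C¹` weak solution for the coefficients `a`, then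
`x ↦ u(x₀ + R·x)` (`R ≠ 0`) is an entire `C¹` weak solution for the coefficients `x ↦ a(x₀ + R·x)` (which have the
same ellipticity constants). -/
theorem weak_comp_affine (hu : ContDiff ℝ 1 u)
    (hweak : ∀ η : EuclideanSpace ℝ (Fin n) → ℝ, ContDiff ℝ 1 η → HasCompactSupport η →
      ∫ y, ∑ i, ∑ j, a y i j * fderiv ℝ u y (EuclideanSpace.single i 1) *
        fderiv ℝ η y (EuclideanSpace.single j 1) = 0)
    (x₀ : EuclideanSpace ℝ (Fin n)) {R : ℝ} (hR : R ≠ 0) :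
    ∀ η : EuclideanSpace ℝ (Fin n) → ℝ, ContDiff ℝ 1 η → HasCompactSupport η →
      ∫ y, ∑ i, ∑ j, a (x₀ + R • y) i j * fderiv ℝ (fun y => u (x₀ + R • y)) y (EuclideanSpace.single i 1) *
        fderiv ℝ η y (EuclideanSpace.single j 1) = 0 := by
  intro η hη hηc
  -- the pulled-back test function `η' = η ∘ T⁻¹`
  set η' : EuclideanSpace ℝ (Fin n) → ℝ := fun z => η (R⁻¹ • (z - x₀)) with hη'
  have hTinv : ∀ y : EuclideanSpace ℝ (Fin n), R⁻¹ • (x₀ + R • y - x₀) = y := by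
    intro y
    rw [add_sub_cancel_left, smul_smul, inv_mul_cancel₀ hR, one_smul]
  have hη'T : ∀ y, η' (x₀ + R • y) = η y := fun y => by simp only [hη', hTinv]
  have hη'd : ContDiff ℝ 1 η' := hη.comp ((contDiff_id.sub contDiff_const).const_smul R⁻¹)
  have hη'c : HasCompactSupport η' := by
    refine HasCompactSupport.intro ((hηc.isCompact).image (show Continuous fun y : EuclideanSpace ℝ (Fin n) =>
      x₀ + R • y by fun_prop)) fun z hz => ?_
    by_contra hne
    apply hz
    refine ⟨R⁻¹ • (z - x₀), subset_tsupport _ (by simpa [hη'] using hne), ?_⟩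
    show x₀ + R • (R⁻¹ • (z - x₀)) = z
    rw [smul_smul, mul_inv_cancel₀ hR, one_smul, add_sub_cancel]
  have h0 := hweak η' hη'd hη'c
  -- pointwise: the integrand is `R² · G(x₀ + R·y)` with `G` the integrand of `h0`
  have hηeq : η = fun y => η' (x₀ + R • y) := funext fun y => (hη'T y).symm
  have hdu : ∀ y (w : EuclideanSpace ℝ (Fin n)), fderiv ℝ (fun y => u (x₀ + R • y)) y w =
      R * fderiv ℝ u (x₀ + R • y) w := fun y w =>
    fderiv_comp_affine x₀ R ((hu.differentiable one_ne_zero) _) w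
  have hdη : ∀ y (w : EuclideanSpace ℝ (Fin n)), fderiv ℝ η y w = R * fderiv ℝ η' (x₀ + R • y) w := by
    intro y w
    rw [hηeq]
    exact fderiv_comp_affine x₀ R ((hη'd.differentiable one_ne_zero) _) w
  set G : EuclideanSpace ℝ (Fin n) → ℝ := fun z => ∑ i, ∑ j, a z i j * fderiv ℝ u z (EuclideanSpace.single i 1) *
    fderiv ℝ η' z (EuclideanSpace.single j 1) with hG
  have hpt : ∀ y, ∑ i, ∑ j, a (x₀ + R • y) i j *
        fderiv ℝ (fun y => u (x₀ + R • y)) y (EuclideanSpace.single i 1) *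
          fderiv ℝ η y (EuclideanSpace.single j 1) = R ^ 2 * G (x₀ + R • y) := by
    intro y
    simp only [hG, hdu, hdη, Finset.mul_sum]
    exact Finset.sum_congr rfl fun i _ => Finset.sum_congr rfl fun j _ => by ring
  simp_rw [hpt]
  rw [integral_const_mul]
  have h1 : ∫ y : EuclideanSpace ℝ (Fin n), G (x₀ + R • y) = |(R ^ Module.finrank ℝ (EuclideanSpace ℝ (Fin n)))⁻¹| *
      ∫ z, G z := by
    have h := Measure.integral_comp_smul (μ := (volume : Measure (EuclideanSpace ℝ (Fin n))))
      (fun z => G (x₀ + z)) R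
    simp only [smul_eq_mul] at h
    rw [h, integral_add_left_eq_self G x₀]
  rw [h1, show (∫ z, G z) = 0 from h0, mul_zero, mul_zero]


/-! ### Harnack on the unit ball ⇒ Liouville -/

/-- **Harnack ⇒ Liouville.**  Fix `(n, λ, Λ)`.  Suppose ONE constant `C` works in the unit-ball Harnack inequality
`u(x) ≤ C·u(y)` (`x, y ∈ B(0,1)`) for every admissible coefficient field (measurable, symmetric, `λ|ξ|² ≤ ξ·aξ`,
`|aᵢⱼ| ≤ Λ`) and every entire `C¹` weak solution `u ≥ 1`.  Then every bounded entire `C¹` weak solution is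
constant.  Proof: with `m = inf u`, `δ = u(x) − m > 0` and `ε > 0`, the function `w = (u(R·) − m)/ε + 1 ≥ 1` is an
entire weak solution for the coefficients `a(R·)` (`weak_comp_affine`, `weak_affine`); Harnack at `x/R`, `y₀/R` with
`u(y₀) < m + ε` gives `δ/ε + 1 ≤ 2C`, absurd for `ε = δ/(2(C+1))`. -/
theorem liouville_of_unitHarnack {lam Λ : ℝ}
    (HU : ∃ C : ℝ, ∀ (a : EuclideanSpace ℝ (Fin n) → Matrix (Fin n) (Fin n) ℝ),
      (∀ i j, Measurable fun y => a y i j) → (∀ y, (a y).IsSymm) →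
      (∀ y (ξ : Fin n → ℝ), lam * (ξ ⬝ᵥ ξ) ≤ ξ ⬝ᵥ (a y *ᵥ ξ)) → (∀ y i j, |a y i j| ≤ Λ) →
      ∀ (u : EuclideanSpace ℝ (Fin n) → ℝ), ContDiff ℝ 1 u → (∀ y, 1 ≤ u y) →
        (∀ η : EuclideanSpace ℝ (Fin n) → ℝ, ContDiff ℝ 1 η → HasCompactSupport η →
          ∫ y, ∑ i, ∑ j, a y i j * fderiv ℝ u y (EuclideanSpace.single i 1) *
            fderiv ℝ η y (EuclideanSpace.single j 1) = 0) →
        ∀ x ∈ ball (0 : EuclideanSpace ℝ (Fin n)) 1, ∀ y ∈ ball (0 : EuclideanSpace ℝ (Fin n)) 1,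
          u x ≤ C * u y)
    (hmeas : ∀ i j, Measurable fun y => a y i j) (hsymm : ∀ y, (a y).IsSymm)
    (hell : ∀ y (ξ : Fin n → ℝ), lam * (ξ ⬝ᵥ ξ) ≤ ξ ⬝ᵥ (a y *ᵥ ξ)) (hbd : ∀ y i j, |a y i j| ≤ Λ)
    (hu : ContDiff ℝ 1 u) (hbdd : ∃ K : ℝ, ∀ y, |u y| ≤ K)
    (hweak : ∀ η : EuclideanSpace ℝ (Fin n) → ℝ, ContDiff ℝ 1 η → HasCompactSupport η →
      ∫ y, ∑ i, ∑ j, a y i j * fderiv ℝ u y (EuclideanSpace.single i 1) *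
        fderiv ℝ η y (EuclideanSpace.single j 1) = 0) :
    ∀ x y, u x = u y := by
  obtain ⟨C, hC⟩ := HU
  obtain ⟨K, hK⟩ := hbdd
  have hbelow : BddBelow (range u) := ⟨-K, by rintro _ ⟨y, rfl⟩; exact (abs_le.mp (hK y)).1⟩
  set m := ⨅ y, u y with hm
  have hm_le : ∀ y, m ≤ u y := fun y => ciInf_le hbelow y
  suffices h : ∀ x, u x = m from fun x y => (h x).trans (h y).symm
  intro x
  refine le_antisymm ?_ (hm_le x)
  by_contra hx
  push Not at hx
  set δ := u x - m with hδdef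
  have hδ : 0 < δ := sub_pos.2 hx
  set ε := δ / (2 * (|C| + 1)) with hε
  have hεpos : 0 < ε := by positivity
  obtain ⟨y₀, hy₀⟩ : ∃ y₀, u y₀ < m + ε := exists_lt_of_ciInf_lt (by rw [← hm]; linarith)
  set R := max ‖x‖ ‖y₀‖ + 1 with hR
  have hRpos : 0 < R := by rw [hR]; positivity
  have hRne : R ≠ 0 := hRpos.ne'
  -- the rescaled coefficients and the rescaled, renormalised solution
  set b : EuclideanSpace ℝ (Fin n) → Matrix (Fin n) (Fin n) ℝ := fun z => a ((0 : EuclideanSpace ℝ (Fin n)) + R • z)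
    with hb
  set w : EuclideanSpace ℝ (Fin n) → ℝ :=
    fun z => ε⁻¹ * u ((0 : EuclideanSpace ℝ (Fin n)) + R • z) + (1 - ε⁻¹ * m) with hw
  have hTc : Continuous fun z : EuclideanSpace ℝ (Fin n) => (0 : EuclideanSpace ℝ (Fin n)) + R • z := by fun_prop
  have hb_meas : ∀ i j, Measurable fun z => b z i j := fun i j => (hmeas i j).comp hTc.measurable
  have hb_symm : ∀ z, (b z).IsSymm := fun z => hsymm _
  have hb_ell : ∀ z (ξ : Fin n → ℝ), lam * (ξ ⬝ᵥ ξ) ≤ ξ ⬝ᵥ (b z *ᵥ ξ) := fun z ξ => hell _ ξ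
  have hb_bd : ∀ z i j, |b z i j| ≤ Λ := fun z i j => hbd _ i j
  have hw_diff : ContDiff ℝ 1 w :=
    (contDiff_const.mul (hu.comp (contDiff_const.add (contDiff_id.const_smul R)))).add contDiff_const
  have hw_val : ∀ z, w z = ε⁻¹ * (u ((0 : EuclideanSpace ℝ (Fin n)) + R • z) - m) + 1 := fun z => by
    simp only [hw]; ring
  have hw_one : ∀ z, 1 ≤ w z := by
    intro z
    rw [hw_val]
    have : 0 ≤ ε⁻¹ * (u ((0 : EuclideanSpace ℝ (Fin n)) + R • z) - m) :=
      mul_nonneg (inv_nonneg.2 hεpos.le) (sub_nonneg.2 (hm_le _))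
    linarith
  have hw_weak := weak_affine (a := b) (hu.comp (contDiff_const.add (contDiff_id.const_smul R)))
    (weak_comp_affine hu hweak 0 hRne) ε⁻¹ (1 - ε⁻¹ * m)
  -- the two points in the unit ball
  have hscale : ∀ z : EuclideanSpace ℝ (Fin n), (0 : EuclideanSpace ℝ (Fin n)) + R • (R⁻¹ • z) = z := by
    intro z; rw [zero_add, smul_smul, mul_inv_cancel₀ hRne, one_smul]
  have hmem : ∀ z : EuclideanSpace ℝ (Fin n), ‖z‖ < R → R⁻¹ • z ∈ ball (0 : EuclideanSpace ℝ (Fin n)) 1 := by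
    intro z hz
    rw [mem_ball_zero_iff, norm_smul, norm_inv, Real.norm_of_nonneg hRpos.le]
    rw [inv_mul_lt_iff₀ hRpos]
    simpa using hz
  have hxR : ‖x‖ < R := by rw [hR]; linarith [le_max_left ‖x‖ ‖y₀‖]
  have hyR : ‖y₀‖ < R := by rw [hR]; linarith [le_max_right ‖x‖ ‖y₀‖]
  have hX := hmem x hxR
  have hY := hmem y₀ hyR
  have hwX : w (R⁻¹ • x) = ε⁻¹ * δ + 1 := by rw [hw_val, hscale]
  have hwY : w (R⁻¹ • y₀) < 2 := by
    rw [hw_val, hscale]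
    have h1 : ε⁻¹ * (u y₀ - m) < 1 := by
      rw [inv_mul_lt_iff₀ hεpos]; linarith
    linarith
  have hεδ : ε⁻¹ * δ = 2 * (|C| + 1) := by
    rw [hε]
    field_simp
  -- Harnack at (X, X) gives `C ≥ 1`, at (X, Y) the contradiction
  have h1 := hC b hb_meas hb_symm hb_ell hb_bd w hw_diff hw_one hw_weak (R⁻¹ • x) hX (R⁻¹ • x) hX
  have hC1 : 1 ≤ C := by
    by_contra hlt
    push Not at hlt
    have hpos : 0 < w (R⁻¹ • x) := zero_lt_one.trans_le (hw_one _)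
    nlinarith
  have h2 := hC b hb_meas hb_symm hb_ell hb_bd w hw_diff hw_one hw_weak (R⁻¹ • x) hX (R⁻¹ • y₀) hY
  rw [hwX, hεδ, abs_of_pos (zero_lt_one.trans_le hC1)] at h2
  nlinarith [hwY, hC1]

end Summit.NavierStokesRegularity.NavierStokesRegularity.Theorems.PoloidalWindowDoorPoloidalWindowRigidityDivFormReduction

end
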